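import Literature.Analysis.Calculus.JacobianNullLagrangian
import Mathlib.Analysis.SpecialFunctions.Sqrt
import Mathlib.Analysis.Calculus.Deriv.Shift
import Mathlib.Analysis.Calculus.Deriv.Inv
import Mathlib.Analysis.Calculus.Deriv.Pow
import Mathlib.Analysis.Calculus.Deriv.Mul
import Mathlib.Analysis.Calculus.LineDeriv.Basic
import Mathlib.LinearAlgebra.Matrix.Determinant.Basic
import Mathlib.Tactic.LinearCombination
import Mathlib.Tactic.FieldSimp

/-!
# `StokesGeneration` (stmt-KontsevichZagierPeriods-3586) — line `fibrewise_stokes`, stub `stub_calabiJacobian`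

Registered stub A0 (RUNG A — the anchor `π²`, wave 8) of the line `fibrewise_stokes` of the crux
`StokesGeneration` (route UnfoldedStokes): **Calabi's substitution in inverse form.** The map

  `Ψ(X, Y) = (X √((1 − Y²)/(1 − X²)), Y √((1 − X²)/(1 − Y²)))`

(the inverse of Calabi's `(u, v) ↦ (sin u / cos v, sin v / cos u)` written in the coordinates
`ξ = tan u`, `η = tan v`) is differentiable at every point `p = (X, Y)` of the open unit square, its
Jacobian determinant is `(1 − X²Y²)/((1 − X²)(1 − Y²))`, and the pulled-back integrand satisfies
`4/((1 + ξ²)(1 + η²)) · det DΨ = 4/(1 − X²Y²)`: this is the one analytic input of the anchor rung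
(`∫∫ 4 dX dY/(1 − X²Y²)` over the triangle is `π²/4`).

Proof sketch. Write `s = √(1 − X²)`, `t = √(1 − Y²)` (`s, t > 0`, `s² = 1 − X²`, `t² = 1 − Y²`).
(1) The components `q ↦ qᵢ √((1 − qⱼ²)/(1 − qᵢ²))` are `Cⁿ` at `p` for every `n` (coordinate
projections, quotient with non-vanishing denominator, `Real.sqrt` away from `0`; `calabi_contDiffAt`),
hence `Ψ` is differentiable at `p`.
(2) The partial derivatives are derivatives along the coordinate lines (`HasFDerivAt.hasLineDerivAt`
and uniqueness of one-variable derivatives), computed by one-variable calculus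
(`calabi_hasDerivAt_diag`, `calabi_hasDerivAt_off`):
`∂ξ/∂X = t/s³`, `∂ξ/∂Y = ∂η/∂X = −XY/(st)`, `∂η/∂Y = s/t³` (`calabi_jacobianMatrix`).
(3) `det = (t/s³)(s/t³) − X²Y²/(s²t²) = (1 − X²Y²)/(s²t²)` (`det_jacobianMatrix`, `Matrix.det_fin_two`).
(4) `1 + ξ² = (1 − X²Y²)/s²`, `1 + η² = (1 − X²Y²)/t²` (`calabi_apply`), whence the last identity.

References: M. Kontsevich, D. Zagier, *Periods* (2001), §1.2 (the evaluation `ζ(2) = π²/6` by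
rules (1)–(3), after F. Beukers, E. Calabi, J. Kolk, *Sums of generalized harmonic series and volumes*,
Nieuw Arch. Wisk. (4) 11 (1993), 217–224).
-/

noncomputable section

-- `Summit.KontsevichZagierPeriods.KontsevichZagierPeriods.…` is the tree's mandated layout (single-conjunct summit).
set_option linter.dupNamespace false

namespace Summit.KontsevichZagierPeriods.KontsevichZagierPeriods.Cruxes.StokesGeneration.FibrewiseStokes

open Set
open Literature.Analysis.Calculus (jacobianMatrix jacobianMatrix_apply det_jacobianMatrix)

/-! ### One-variable derivatives of the components -/

/-- The diagonal partial derivative: for `s, t > 0` with `s² = 1 − X²`, `t² = B`,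
`d/dx [x √(B/(1 − x²))] (X) = t/s³` (`= √(B/(1−X²)) · (1 + X²/(1 − X²))`). [folklore] -/
private theorem calabi_hasDerivAt_diag {X B s t : ℝ} (hs : 0 < s) (ht : 0 < t)
    (hs2 : s ^ 2 = 1 - X ^ 2) (ht2 : t ^ 2 = B) :
    HasDerivAt (fun x : ℝ => x * √(B / (1 - x ^ 2))) (t / s ^ 3) X := by
  have ha : (1 - X ^ 2) ≠ 0 := by rw [← hs2]; positivity
  have hr : B / (1 - X ^ 2) ≠ 0 := by rw [← hs2, ← ht2]; positivity
  have hsq : √(B / (1 - X ^ 2)) = t / s := by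
    rw [← hs2, ← ht2, Real.sqrt_div' _ (sq_nonneg s), Real.sqrt_sq hs.le, Real.sqrt_sq ht.le]
  have hd : HasDerivAt (fun x : ℝ => 1 - x ^ 2) (-(↑(2:ℕ) * X ^ (2 - 1))) X :=
    (hasDerivAt_pow 2 X).const_sub 1
  have hq := ((hasDerivAt_const X B).fun_div hd ha).sqrt hr
  refine ((hasDerivAt_id' X).fun_mul hq).congr_deriv ?_
  rw [hsq, ← hs2, ← ht2]
  field_simp
  linear_combination (2 * t ^ 2) * hs2

/-- The off-diagonal partial derivative: for `s, t > 0` with `s² = A`, `t² = 1 − Y²`,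
`d/dy [c √((1 − y²)/A)] (Y) = −cY/(st)`. [folklore] -/
private theorem calabi_hasDerivAt_off {Y A s t : ℝ} (c : ℝ) (hs : 0 < s) (ht : 0 < t)
    (hs2 : s ^ 2 = A) (ht2 : t ^ 2 = 1 - Y ^ 2) :
    HasDerivAt (fun y : ℝ => c * √((1 - y ^ 2) / A)) (-(c * Y) / (s * t)) Y := by
  have hr : (1 - Y ^ 2) / A ≠ 0 := by rw [← hs2, ← ht2]; positivity
  have hsq : √((1 - Y ^ 2) / A) = t / s := by
    rw [← hs2, ← ht2, Real.sqrt_div' _ (sq_nonneg s), Real.sqrt_sq hs.le, Real.sqrt_sq ht.le]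
  have hd : HasDerivAt (fun y : ℝ => 1 - y ^ 2) (-(↑(2:ℕ) * Y ^ (2 - 1))) Y :=
    (hasDerivAt_pow 2 Y).const_sub 1
  refine (((hd.div_const A).sqrt hr).const_mul c).congr_deriv ?_
  rw [hsq, ← hs2]
  field_simp
  ring

/-! ### The components `q ↦ qᵢ √((1 − qⱼ²)/(1 − qᵢ²))` on `ℝ²` -/

/-- A component `q ↦ qᵢ √((1 − qⱼ²)/(1 − qᵢ²))` (`i ≠ j`) of Calabi's map is `Cⁿ` at a point `p`
with `pᵢ² < 1`, `pⱼ² < 1` (encoded by `s, t > 0`, `s² = 1 − pᵢ²`, `t² = 1 − pⱼ²`), and its partial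
derivatives there are `∂ᵢ = t/s³`, `∂ⱼ = −pᵢpⱼ/(st)`: the partials are derivatives along the
coordinate lines (`HasFDerivAt.hasLineDerivAt`), computed by `calabi_hasDerivAt_diag/off`.
[folklore] -/
private theorem calabi_component {p : Fin 2 → ℝ} {i j : Fin 2} (hij : i ≠ j) {s t : ℝ}
    (hs : 0 < s) (ht : 0 < t) (hs2 : s ^ 2 = 1 - p i ^ 2) (ht2 : t ^ 2 = 1 - p j ^ 2) :
    (∀ n : WithTop ℕ∞,
      ContDiffAt ℝ n (fun q : Fin 2 → ℝ => q i * √((1 - q j ^ 2) / (1 - q i ^ 2))) p) ∧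
    fderiv ℝ (fun q : Fin 2 → ℝ => q i * √((1 - q j ^ 2) / (1 - q i ^ 2))) p (Pi.single i 1) =
      t / s ^ 3 ∧
    fderiv ℝ (fun q : Fin 2 → ℝ => q i * √((1 - q j ^ 2) / (1 - q i ^ 2))) p (Pi.single j 1) =
      -(p i * p j) / (s * t) := by
  have ha : 1 - p i ^ 2 ≠ 0 := by rw [← hs2]; positivity
  have hr : (1 - p j ^ 2) / (1 - p i ^ 2) ≠ 0 := by rw [← hs2, ← ht2]; positivity
  have hC : ∀ n : WithTop ℕ∞,
      ContDiffAt ℝ n (fun q : Fin 2 → ℝ => q i * √((1 - q j ^ 2) / (1 - q i ^ 2))) p := by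
    intro n
    fun_prop (disch := assumption)
  have hD : DifferentiableAt ℝ (fun q : Fin 2 → ℝ => q i * √((1 - q j ^ 2) / (1 - q i ^ 2))) p :=
    (hC 1).differentiableAt one_ne_zero
  -- the partial derivatives are the derivatives along the coordinate lines through `p`
  have hline : ∀ k : Fin 2, HasDerivAt (fun τ : ℝ =>
      (fun q : Fin 2 → ℝ => q i * √((1 - q j ^ 2) / (1 - q i ^ 2))) (p + τ • Pi.single k 1))
      (fderiv ℝ (fun q : Fin 2 → ℝ => q i * √((1 - q j ^ 2) / (1 - q i ^ 2))) p (Pi.single k 1)) 0 :=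
    fun k => hD.hasFDerivAt.hasLineDerivAt _
  refine ⟨hC, ?_, ?_⟩
  · -- along `e_i`: the line is `τ ↦ (p i + τ) √((1 − p j²)/(1 − (p i + τ)²))`
    have he : (fun τ : ℝ =>
        (fun q : Fin 2 → ℝ => q i * √((1 - q j ^ 2) / (1 - q i ^ 2))) (p + τ • Pi.single i 1)) =
        fun τ : ℝ => (p i + τ) * √((1 - p j ^ 2) / (1 - (p i + τ) ^ 2)) := by
      funext τ
      simp [hij.symm]
    have hl := hline i
    rw [he] at hl
    refine hl.unique ?_
    exact HasDerivAt.comp_const_add (p i) 0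
      (f := fun x : ℝ => x * √((1 - p j ^ 2) / (1 - x ^ 2)))
      (by rw [add_zero]; exact calabi_hasDerivAt_diag hs ht hs2 ht2)
  · -- along `e_j`: the line is `τ ↦ p i √((1 − (p j + τ)²)/(1 − p i²))`
    have he : (fun τ : ℝ =>
        (fun q : Fin 2 → ℝ => q i * √((1 - q j ^ 2) / (1 - q i ^ 2))) (p + τ • Pi.single j 1)) =
        fun τ : ℝ => p i * √((1 - (p j + τ) ^ 2) / (1 - p i ^ 2)) := by
      funext τ
      simp [hij]
    have hl := hline j
    rw [he] at hl
    refine hl.unique ?_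
    exact HasDerivAt.comp_const_add (p j) 0
      (f := fun y : ℝ => p i * √((1 - y ^ 2) / (1 - p i ^ 2)))
      (by rw [add_zero]; exact calabi_hasDerivAt_off (p i) hs ht hs2 ht2)

/-! ### Public corollaries: smoothness, Jacobian matrix, values -/

/-- **Calabi's map is smooth on the open square**: `Ψ(X, Y) = (X√((1−Y²)/(1−X²)), Y√((1−X²)/(1−Y²)))`
is `Cⁿ` (every `n`, including `ω`) at every point of `(0,1)²`. [cite: KontsevichZagier2001, §1.2] -/
theorem calabi_contDiffAt (Ψ : (Fin 2 → ℝ) → (Fin 2 → ℝ))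
    (hΨ : Ψ = fun q => ![q 0 * Real.sqrt ((1 - q 1 ^ 2) / (1 - q 0 ^ 2)),
      q 1 * Real.sqrt ((1 - q 0 ^ 2) / (1 - q 1 ^ 2))])
    (p : Fin 2 → ℝ) (h0 : p 0 ∈ Set.Ioo (0:ℝ) 1) (h1 : p 1 ∈ Set.Ioo (0:ℝ) 1) (n : WithTop ℕ∞) :
    ContDiffAt ℝ n Ψ p := by
  have hX : 0 < 1 - p 0 ^ 2 := by nlinarith [h0.1, h0.2]
  have hY : 0 < 1 - p 1 ^ 2 := by nlinarith [h1.1, h1.2]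
  have hs := Real.sqrt_pos.2 hX
  have ht := Real.sqrt_pos.2 hY
  have hs2 := Real.sq_sqrt hX.le
  have ht2 := Real.sq_sqrt hY.le
  have h01 : (0 : Fin 2) ≠ 1 := by decide
  refine contDiffAt_pi.2 fun k => ?_
  fin_cases k
  · simpa [hΨ] using (calabi_component h01 hs ht hs2 ht2).1 n
  · simpa [hΨ] using (calabi_component h01.symm ht hs ht2 hs2).1 n

/-- Calabi's map is `Cⁿ` (every `n`) on the open unit square `(0,1)²`. [cite: KontsevichZagier2001, §1.2] -/
theorem calabi_contDiffOn (Ψ : (Fin 2 → ℝ) → (Fin 2 → ℝ))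
    (hΨ : Ψ = fun q => ![q 0 * Real.sqrt ((1 - q 1 ^ 2) / (1 - q 0 ^ 2)),
      q 1 * Real.sqrt ((1 - q 0 ^ 2) / (1 - q 1 ^ 2))]) (n : WithTop ℕ∞) :
    ContDiffOn ℝ n Ψ (Set.pi Set.univ (fun _ : Fin 2 => Set.Ioo (0:ℝ) 1)) :=
  fun p hp => (calabi_contDiffAt Ψ hΨ p (hp 0 (Set.mem_univ _)) (hp 1 (Set.mem_univ _)) n).contDiffWithinAt

/-- **The Jacobian matrix of Calabi's map** at a point `(X, Y)` of the open square, in the tree's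
convention `(jacobianMatrix Ψ p) k l = ∂ₗ Ψₖ (p)`: with `s = √(1 − X²)`, `t = √(1 − Y²)`,
`DΨ = [[t/s³, −XY/(st)], [−XY/(st), s/t³]]`, and `Ψ` is differentiable there.
[cite: KontsevichZagier2001, §1.2] -/
theorem calabi_jacobianMatrix (Ψ : (Fin 2 → ℝ) → (Fin 2 → ℝ))
    (hΨ : Ψ = fun q => ![q 0 * Real.sqrt ((1 - q 1 ^ 2) / (1 - q 0 ^ 2)),
      q 1 * Real.sqrt ((1 - q 0 ^ 2) / (1 - q 1 ^ 2))])
    (p : Fin 2 → ℝ) (h0 : p 0 ∈ Set.Ioo (0:ℝ) 1) (h1 : p 1 ∈ Set.Ioo (0:ℝ) 1) :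
    DifferentiableAt ℝ Ψ p ∧
    jacobianMatrix Ψ p 0 0 = Real.sqrt (1 - p 1 ^ 2) / Real.sqrt (1 - p 0 ^ 2) ^ 3 ∧
    jacobianMatrix Ψ p 0 1 = -(p 0 * p 1) / (Real.sqrt (1 - p 0 ^ 2) * Real.sqrt (1 - p 1 ^ 2)) ∧
    jacobianMatrix Ψ p 1 0 = -(p 0 * p 1) / (Real.sqrt (1 - p 0 ^ 2) * Real.sqrt (1 - p 1 ^ 2)) ∧
    jacobianMatrix Ψ p 1 1 = Real.sqrt (1 - p 0 ^ 2) / Real.sqrt (1 - p 1 ^ 2) ^ 3 := by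
  have hX : 0 < 1 - p 0 ^ 2 := by nlinarith [h0.1, h0.2]
  have hY : 0 < 1 - p 1 ^ 2 := by nlinarith [h1.1, h1.2]
  have hs := Real.sqrt_pos.2 hX
  have ht := Real.sqrt_pos.2 hY
  have hs2 := Real.sq_sqrt hX.le
  have ht2 := Real.sq_sqrt hY.le
  have h01 : (0 : Fin 2) ≠ 1 := by decide
  obtain ⟨hC0, h00, h01'⟩ := calabi_component h01 hs ht hs2 ht2
  obtain ⟨hC1, h11, h10⟩ := calabi_component h01.symm ht hs ht2 hs2
  -- the components of `Ψ`
  have hΨ0 : (fun q => Ψ q 0) = fun q : Fin 2 → ℝ => q 0 * √((1 - q 1 ^ 2) / (1 - q 0 ^ 2)) := by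
    funext q
    simp [hΨ]
  have hΨ1 : (fun q => Ψ q 1) = fun q : Fin 2 → ℝ => q 1 * √((1 - q 0 ^ 2) / (1 - q 1 ^ 2)) := by
    funext q
    simp [hΨ]
  have hdiff : DifferentiableAt ℝ Ψ p := by
    refine differentiableAt_pi.2 fun k => ?_
    fin_cases k
    · simpa [hΨ] using (hC0 1).differentiableAt one_ne_zero
    · simpa [hΨ] using (hC1 1).differentiableAt one_ne_zero
  -- entries of the Jacobian: row `k` is the derivative of the component `Ψ · k`
  have hentry : ∀ k l, jacobianMatrix Ψ p k l = fderiv ℝ (fun q => Ψ q k) p (Pi.single l 1) := by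
    intro k l
    rw [jacobianMatrix_apply, fderiv_apply hdiff k]
    rfl
  refine ⟨hdiff, ?_, ?_, ?_, ?_⟩
  · rw [hentry, hΨ0, h00]
  · rw [hentry, hΨ0, h01']
  · rw [hentry, hΨ1, h10, mul_comm (p 1) (p 0), mul_comm (√(1 - p 1 ^ 2)) (√(1 - p 0 ^ 2))]
  · rw [hentry, hΨ1, h11]

/-- **Values of Calabi's map**: at `(X, Y)` in the open square, `ξ = X t/s`, `η = Y s/t`
(`s = √(1 − X²)`, `t = √(1 − Y²)`), and `1 + ξ² = (1 − X²Y²)/(1 − X²)`, `1 + η² = (1 − X²Y²)/(1 − Y²)`.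
[cite: KontsevichZagier2001, §1.2] -/
theorem calabi_apply (Ψ : (Fin 2 → ℝ) → (Fin 2 → ℝ))
    (hΨ : Ψ = fun q => ![q 0 * Real.sqrt ((1 - q 1 ^ 2) / (1 - q 0 ^ 2)),
      q 1 * Real.sqrt ((1 - q 0 ^ 2) / (1 - q 1 ^ 2))])
    (p : Fin 2 → ℝ) (h0 : p 0 ∈ Set.Ioo (0:ℝ) 1) (h1 : p 1 ∈ Set.Ioo (0:ℝ) 1) :
    Ψ p 0 = p 0 * Real.sqrt (1 - p 1 ^ 2) / Real.sqrt (1 - p 0 ^ 2) ∧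
    Ψ p 1 = p 1 * Real.sqrt (1 - p 0 ^ 2) / Real.sqrt (1 - p 1 ^ 2) ∧
    1 + (Ψ p 0) ^ 2 = (1 - (p 0 * p 1) ^ 2) / (1 - p 0 ^ 2) ∧
    1 + (Ψ p 1) ^ 2 = (1 - (p 0 * p 1) ^ 2) / (1 - p 1 ^ 2) := by
  have hX : 0 < 1 - p 0 ^ 2 := by nlinarith [h0.1, h0.2]
  have hY : 0 < 1 - p 1 ^ 2 := by nlinarith [h1.1, h1.2]
  have hv0 : Ψ p 0 = p 0 * Real.sqrt (1 - p 1 ^ 2) / Real.sqrt (1 - p 0 ^ 2) := by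
    simp only [hΨ, Matrix.cons_val_zero]
    rw [Real.sqrt_div' _ hX.le, mul_div_assoc]
  have hv1 : Ψ p 1 = p 1 * Real.sqrt (1 - p 0 ^ 2) / Real.sqrt (1 - p 1 ^ 2) := by
    simp only [hΨ, Matrix.cons_val_one, Matrix.cons_val_zero]
    rw [Real.sqrt_div' _ hY.le, mul_div_assoc]
  refine ⟨hv0, hv1, ?_, ?_⟩
  · rw [hv0, div_pow, mul_pow, Real.sq_sqrt hX.le, Real.sq_sqrt hY.le]
    field_simp
    ring
  · rw [hv1, div_pow, mul_pow, Real.sq_sqrt hX.le, Real.sq_sqrt hY.le]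
    field_simp
    ring

/-! ### The registered stub -/

/-- **Registered stub `stub_calabiJacobian` (RUNG A, A0): Calabi's substitution in inverse form.**
`Ψ(X, Y) = (X√((1−Y²)/(1−X²)), Y√((1−X²)/(1−Y²)))` is differentiable at every point of the open unit
square, with Jacobian determinant `(1 − X²Y²)/((1 − X²)(1 − Y²))`, and
`4/((1 + ξ²)(1 + η²)) · det DΨ = 4/(1 − X²Y²)` (`(ξ, η) = Ψ(X, Y)`): the pull-back of
`4 dX dY/(1 − X²Y²)` is `4 dξ dη/((1 + ξ²)(1 + η²))`. [cite: KontsevichZagier2001, §1.2] -/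
theorem stub_calabiJacobian (Ψ : (Fin 2 → ℝ) → (Fin 2 → ℝ))
    (hΨ : Ψ = fun q => ![q 0 * Real.sqrt ((1 - q 1 ^ 2) / (1 - q 0 ^ 2)), q 1 * Real.sqrt ((1 - q 0 ^ 2) / (1 - q 1 ^ 2))])
    (p : Fin 2 → ℝ) (h0 : p 0 ∈ Set.Ioo (0:ℝ) 1) (h1 : p 1 ∈ Set.Ioo (0:ℝ) 1) :
    DifferentiableAt ℝ Ψ p ∧
      (fderiv ℝ Ψ p).det = (1 - (p 0 * p 1) ^ 2) / ((1 - p 0 ^ 2) * (1 - p 1 ^ 2)) ∧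
      4 / ((1 + (Ψ p 0) ^ 2) * (1 + (Ψ p 1) ^ 2)) * (fderiv ℝ Ψ p).det = 4 / (1 - (p 0 * p 1) ^ 2) := by
  have hX : 0 < 1 - p 0 ^ 2 := by nlinarith [h0.1, h0.2]
  have hY : 0 < 1 - p 1 ^ 2 := by nlinarith [h1.1, h1.2]
  have hXY : 0 < 1 - (p 0 * p 1) ^ 2 := by
    have : p 0 * p 1 < 1 := by nlinarith [h0.1, h0.2, h1.1, h1.2]
    nlinarith [mul_pos h0.1 h1.1]
  obtain ⟨hdiff, h00, h01, h10, h11⟩ := calabi_jacobianMatrix Ψ hΨ p h0 h1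
  obtain ⟨-, -, hq0, hq1⟩ := calabi_apply Ψ hΨ p h0 h1
  -- the determinant, computed from the entries with `s = √(1 − X²)`, `t = √(1 − Y²)` kept opaque
  have key : ∀ s t : ℝ, 0 < s → 0 < t → s ^ 2 = 1 - p 0 ^ 2 → t ^ 2 = 1 - p 1 ^ 2 →
      t / s ^ 3 * (s / t ^ 3) - -(p 0 * p 1) / (s * t) * (-(p 0 * p 1) / (s * t)) =
        (1 - (p 0 * p 1) ^ 2) / ((1 - p 0 ^ 2) * (1 - p 1 ^ 2)) := by
    intro s t hs ht hs2 ht2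
    rw [← hs2, ← ht2]
    field_simp
  have hdet : (fderiv ℝ Ψ p).det = (1 - (p 0 * p 1) ^ 2) / ((1 - p 0 ^ 2) * (1 - p 1 ^ 2)) := by
    rw [← det_jacobianMatrix, Matrix.det_fin_two, h00, h01, h10, h11]
    exact key _ _ (Real.sqrt_pos.2 hX) (Real.sqrt_pos.2 hY) (Real.sq_sqrt hX.le) (Real.sq_sqrt hY.le)
  refine ⟨hdiff, hdet, ?_⟩
  rw [hdet, hq0, hq1]
  field_simp

end Summit.KontsevichZagierPeriods.KontsevichZagierPeriods.Cruxes.StokesGeneration.FibrewiseStokes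

end
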